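import Literature.NumberTheory.ComplexMultiplication.MainTheoremCMLevelStructureCore
import Literature.AlgebraicGeometry.Motives.AbelianVarietyGoodReductionHomConjFrobTate
import HarnessLib

/-!
# The main theorem of complex multiplication — the level-`N` structure over a level field, edition `S5c′` (Shimura 1998, §18.6, proof of Thm. 18.6, pp. 127–129)

Topic `Literature/NumberTheory/ComplexMultiplication`, namespace `Literature.NumberTheory.ComplexMultiplication`.
THEOREMS ONLY (no definition, no named fact; net Literature debt **0**).  Cell `hodgecm-mathlib` (D-0151), fan B-II, line
`b2-main-theorem-cm` (crux `stmt-HodgeConjecture-24834`), stub S7a (`StubComposition → levelStructure`).  SIBLING of the per-level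
CORE `exists_isLevelUniformization_of_levelField_degOne` (`MainTheoremCMLevelStructureCore.lean`, p610823/p616313) for EDITION E4
(E4 gate ruling B-p20 2026-08-28T08:27:54Z (2), director g3 BATCH 90): the two reduction-theoretic fact binders of the core —
`hRH` (the body of the theorem `FactRH′`: cofinite produced reduction data with `Nonempty` reduction-of-homomorphisms witnesses) and
`hS5c` (the named fact F-S5c `exists_isTateCompatible_family_conjFrob` for ARBITRARY data) — are replaced by the ONE merged named
fact `S5c′` = `AbelianVariety.exists_finite_forall_exists_goodReductionAt_homReduction_conjFrob_isTateCompatible`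
(`AbelianVarietyGoodReductionHomConjFrobTate.lean`: `FactRH′`'s prefix with `∃`-DATA `H`, `Hγ`, `Hγ′` and the F-S5c body BY NAME for
the SAME witnesses, every `ℓ`).  The proof is the core's proof verbatim; only the junction §1–§2 changes (the data at the Frobenius
prime are destructured from the one binder instead of chosen from `Nonempty` witnesses and fed to a universally quantified F-S5c),
so no choice of reduction data remains.  `exists_isLevelUniformization_of_levelField_degOne'` takes the degree-one pair fact
`shimuraTaniyamaPair_degOne` (edition E1); `exists_isLevelUniformization_of_levelField'` is its one-line `shimuraTaniyamaPair`
corollary through `shimuraTaniyamaPair_degOne_of`.  EDITION E1′ (director g3 BATCH 103, A-p02's E2 road memo): the heavy proof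
now takes the UNRAMIFIED degree-one fact `shimuraTaniyamaPair_degOne'` (`exists_isLevelUniformization_of_levelField_degOne''`, the
Frobenius prime being chosen prime to `N · |d(K)|`), and `…_degOne'` is its one-line corollary through `shimuraTaniyamaPair_degOne'_of`
(statement byte-identical to p618655).  HC_CM is proved only modulo the 7 printed citations until rung 0 closes; nothing here
changes that.

## References

* [Shimura1998] G. Shimura, *Abelian Varieties with Complex Multiplication and Modular Functions*, Princeton Univ. Press
  1998: §18.6, proof of Thm. 18.6, pp. 125–129 (the passage used, pp. 127–129, = held chunks p0166–p0169); §13.1 Thm. 1 (i) (p. 97);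
  §11.1 Prop. 12 (p. 83), Prop. 14 (i) (p. 85); §8.3 Prop. 28 (p. 62); §7.4 Prop. 15–17 (pp. 53–54). Pages per lit/PAGE-DELTAS-Shimura1998.md.
* [BombieriGubler2006] E. Bombieri, W. Gubler, *Heights in Diophantine Geometry*, Cambridge 2006, 10.3.9 (Néron model).
* [SerreTate1968] J.-P. Serre, J. Tate, *Good reduction of abelian varieties*, Ann. of Math. 88 (1968), §1 Thm. 1.
-/

set_option autoImplicit false

noncomputable section

open CategoryTheory CategoryTheory.Limits AlgebraicGeometry NumberField IsDedekindDomain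
open scoped NumberField nonZeroDivisors
open Literature.AlgebraicGeometry.Motives Literature.AlgebraicGeometry.Motives.AbelianVariety
open Literature.AlgebraicGeometry.Motives.AbelianVariety.GoodReductionAt
open Literature.AlgebraicGeometry.ComplexMultiplication
open Literature.AlgebraicGeometry.Motives.HodgeStructure (cmTypeSmul)
open Literature.NumberTheory.NumberFields
open Literature.NumberTheory.GaloisRepresentations (ideleGroup localUnits galFrob principalIdele HeckeCharacter)
open FractionalIdeal (spanSingleton)
open Literature.NumberTheory.Automorphic.FiniteAdeleRing (toFractionalIdeal)

namespace Literature.NumberTheory.ComplexMultiplication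

-- one declaration assembling ≈ 20 tree theorems over scheme-valued structures: the cumulative elaboration budget of the
-- proof exceeds the default (measured ≈ 3× on the farm); no single step is a brute-force search.
set_option maxHeartbeats 800000 in
/-- **Shimura 1998, proof of Thm. 18.6, pp. 127–129, for ONE level `N` over a chosen level field `L₁` — edition
`S5c′`**: the level-`N` uniformisation `ξ′` of `((A₀ ⊗ ℂ)^σ, (ι₀ ⊗ ℂ)^σ)` with (2)_N and the relative polarisation clause
(`IsLevelUniformization`), from the junction's binders, the LEVEL FIELD `L₁` with the class-representative models and the
rationality hypotheses (as in `exists_isLevelUniformization_of_levelField_degOne`), the Shimura–Taniyama pair fact at absolute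
degree one AND UNRAMIFIED IN `K`, `shimuraTaniyamaPair_degOne'` (§13.1 Thm. 1 (i) at `N𝔭 = p`, `p ∤ d(K)`; edition E1′,
director g3 BATCH 103 — the Frobenius prime is chosen prime to `N · |d(K)|`, which costs nothing) and the ONE merged reduction fact `S5c′`
`AbelianVariety.exists_finite_forall_exists_goodReductionAt_homReduction_conjFrob_isTateCompatible` (§11.1 Prop. 12, Prop. 14 (i),
§18.6 pp. 127–128: cofinite good-reduction data of the finite family `{A₀ ⊗ L₁} ∪ {A_c}`, reduction-of-homomorphisms data among them
and to/from the Frobenius conjugate, and for every `ℓ` the Tate-compatible `ℓ`-adic specialisations with «`(t^σ̃)~ = π(t̃)`»).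
Proof = the proof of `exists_isLevelUniformization_of_levelField_degOne` with the junction §1–§2 reading the data at the
Frobenius prime `v` (chosen by `exists_frobeniusPrime` outside the finite exceptional set) off the one binder; §3–§16 verbatim
(`exists_abRestrict_ideleArtinMap_eq_galFrob_of_isArtinLift`, `exists_reflexNorm_torsionCongruence_of_abRestrict_ideleArtinMap_eq_galFrob`,
`levelArithmetic_of_latticeIdentity`, `exists_reflexTypeNorm_bridge_traceField`, `exists_hom_iso_redHom_comp_eq_relFrobenius_of_pair_degOne'`,
`map_eq_conjPoints_of_forall_prime`, `conjPoints_eq_map_of_forall_torsion`, `exists_reindex_forall_conj_eq_of_torsionCongruence_units`,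
`weilPairingLevel_conjugate_reindex_eq_pow_of_model`).  The landed `S2₁`-edition `…_degOne'` and the `S2`-edition `…'` follow in one
line each below.  Cell hodgecm-mathlib, line b2-main-theorem-cm, stub S7a, editions E4 + E1′.
[cite: Shimura1998, §18.6 proof of Thm. 18.6, pp. 125–129 (esp. pp. 127–128); §13.1 Thm. 1 (i) (p. 97); §11.1 Prop. 12 (p. 83) and Prop. 14 (i) (p. 85)]
[cite: BombieriGubler2006, 10.3.9 (p. 334)] -/
theorem exists_isLevelUniformization_of_levelField_degOne''
    {K : Type} [Field K] [NumberField K] [IsCMField K] (Φ : CMType K) [NumberField (traceField Φ)]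
    (𝔞 𝔟 : (FractionalIdeal (𝓞 K)⁰ K)ˣ)
    {L : Type} [Field L] [NumberField L] [Algebra L ℂ] (A₀ : AbelianVariety L) (ι₀ : 𝓞 K →+* End A₀)
    (hA₀ : IsCMTypeRealisationOver Φ A₀ ι₀)
    (X : CartierDivisor A₀.X.left)
    (πA : (A₀.baseChange ℂ).X.left ⟶ A₀.X.left) (hπA : πA = pullback.fst A₀.X.hom (bcSpec L ℂ)) [IsDominant πA]
    (ξ : CMTypeUniformization Φ 𝔞 (A₀.baseChange ℂ) ((endBaseChange ℂ A₀).comp ι₀))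
    (σ : ℂ ≃ₐ[traceField Φ] ℂ) (s : ideleGroup (traceField Φ)) (hs : IsArtinLift (traceField Φ) s σ)
    (h𝔟 : 𝔟 = ideleMulIdealUnits (reflexNormFinitePart K Φ (traceField Φ) s)⁻¹ 𝔞)
    (πσ : ((A₀.baseChange ℂ).conjugate σ.toRingEquiv).X.left ⟶ (A₀.baseChange ℂ).X.left)
    (hπσ : πσ = baseChangeHomFst σ.toRingEquiv.toRingHom (A₀.baseChange ℂ).X) [IsDominant πσ]
    (ℓ : ℕ) [Fact ℓ.Prime]
    [hdomA : ∀ k : ℕ, IsDominant (Hom.toSchemeHom (((ℓ ^ k : ℕ) : ℤ) • 𝟙 (A₀.baseChange ℂ)))]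
    [hdomσ : ∀ k : ℕ,
      IsDominant (Hom.toSchemeHom (((ℓ ^ k : ℕ) : ℤ) • 𝟙 ((A₀.baseChange ℂ).conjugate σ.toRingEquiv)))]
    (N : ℕ) (hN : 0 < N) (hℓN : ℓ ∣ N)
    -- level field `L₁ ⊇ L · K* · C_N`, Galois over `K*`, `σ(L₁) = L₁` with `σ|_{L₁} = γ`
    {L₁ : Type} [Field L₁] [NumberField L₁] [Algebra L L₁] [Algebra L₁ ℂ] [IsScalarTower L L₁ ℂ]
    [Algebra (traceField Φ) L₁] [IsScalarTower (traceField Φ) L₁ ℂ] [IsGalois (traceField Φ) L₁]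
    (γ : L₁ ≃ₐ[traceField Φ] L₁) (hσγ : ∀ x : L₁, σ (algebraMap L₁ ℂ x) = algebraMap L₁ ℂ (γ x))
    (j : rayClassField (traceField Φ) (Ideal.span {((N : ℕ) : 𝓞 (traceField Φ))}) →ₐ[traceField Φ] L₁)
    -- class representatives over `L₁` (W(ii) + G0 tower)
    (Arep : ClassGroup (𝓞 K) → AbelianVariety L₁) (ιrep : ∀ c, 𝓞 K →+* End (Arep c))
    (𝔞rep : ClassGroup (𝓞 K) → (FractionalIdeal (𝓞 K)⁰ K)ˣ) (h𝔞rep : ∀ c, ClassGroup.mk K (𝔞rep c) = c)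
    (ηrep : ∀ c, CMTypeUniformization Φ (𝔞rep c) ((Arep c).baseChange ℂ) ((endBaseChange ℂ (Arep c)).comp (ιrep c)))
    -- rationality over `L₁`: `N`-torsion of `A₀ ⊗ ℂ` (G2) and homomorphisms (G1)
    (htors : ∀ Q ∈ (A₀.baseChange ℂ).torsionPoints ℂ (N : ℤ),
      ∃ x ∈ (A₀.baseChange L₁).torsionPoints L₁ (N : ℤ),
        AlgPoints.map (baseChangeTowerIso L L₁ ℂ A₀).hom.hom.hom.hom
          ((A₀.baseChange L₁).pointsMulEquiv ℂ (AlgPoints.extendScalars (A₀.baseChange L₁).X L₁ ℂ x)) = Q)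
    (hrat : ∀ c, Function.Surjective (Hom.baseChange ℂ :
      (A₀.baseChange L₁ ⟶ Arep c) → ((A₀.baseChange L₁).baseChange ℂ ⟶ (Arep c).baseChange ℂ)))
    (hrat' : ∀ c, Function.Surjective (Hom.baseChange ℂ :
      (Arep c ⟶ A₀.baseChange L₁) → ((Arep c).baseChange ℂ ⟶ (A₀.baseChange L₁).baseChange ℂ)))
    (hratγ : ∀ c, Function.Surjective (Hom.baseChange ℂ :
      (Arep c ⟶ (A₀.baseChange L₁).conjugate γ.toRingEquiv) →
        ((Arep c).baseChange ℂ ⟶ ((A₀.baseChange L₁).conjugate γ.toRingEquiv).baseChange ℂ)))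
    (hratγ' : ∀ c, Function.Surjective (Hom.baseChange ℂ :
      ((A₀.baseChange L₁).conjugate γ.toRingEquiv ⟶ Arep c) →
        (((A₀.baseChange L₁).conjugate γ.toRingEquiv).baseChange ℂ ⟶ (Arep c).baseChange ℂ)))
    -- the named facts: the UNRAMIFIED degree-one pair fact `S2₁′` (E1′) and the merged reduction fact `S5c′` (E4)
    (hS2 : shimuraTaniyamaPair_degOne')
    (hRHS5c : AbelianVariety.exists_finite_forall_exists_goodReductionAt_homReduction_conjFrob_isTateCompatible) :
    ∃ (ξ' : CMTypeUniformization Φ 𝔟 ((A₀.baseChange ℂ).conjugate σ.toRingEquiv)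
        (((A₀.baseChange ℂ).endConjugate σ.toRingEquiv).comp ((endBaseChange ℂ A₀).comp ι₀))) (q : ℕ) (β : K),
      IsLevelUniformization Φ 𝔞 𝔟 A₀ ι₀ X πA ξ σ s πσ ℓ N ξ' q β
        ((FractionalIdeal.absNorm (toFractionalIdeal (𝓞 (traceField Φ)) (traceField Φ)
          (IdeleAction.finitePart (traceField Φ) s)) : ℚ) : K) := by
  classical
  have hN0 : N ≠ 0 := Nat.pos_iff_ne_zero.mp hN
  subst h𝔟
  -- §0  `σΦ = Φ` (Prop. 28; G9)
  have hΦ : cmTypeSmul σ.toRingEquiv Φ = Φ := cmTypeSmul_algEquiv_traceField Φ σ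
  -- §1  the finite family over `L₁` (`none ↦ A₀ ⊗ L₁`, `some c ↦ Arep c`): its cofinite PRODUCED reduction data
  --     (the one binder `S5c′`: cofinite data, companions and the `ℓ`-adic block for every `ℓ′`; one `S` for the family)
  let Fam : Option (ClassGroup (𝓞 K)) → AbelianVariety L₁ := fun o => o.elim (A₀.baseChange L₁) Arep
  obtain ⟨S, hSfin, hSdata⟩ := hRHS5c Fam
  -- §2  G5: the Frobenius prime `v` of `L₁` (degree one over `ℚ`, unramified, `v ∉ S`, `v ∤ N`, `γ = Frob_v`)
  --     E1′: the prime is chosen prime to `N · |d(K)|`, so that `p ∤ d(K)` (`hdisc`, the extra hypothesis of `S2₁′`)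
  have hM0 : N * (NumberField.discr K).natAbs ≠ 0 :=
    mul_ne_zero hN0 (Int.natAbs_ne_zero.mpr (NumberField.discr_ne_zero K))
  obtain ⟨v, p, hvS, hp, hpM, hpv, hMv, hchar, hγv, hcard, hunr, huniq⟩ := exists_frobeniusPrime γ hSfin hM0
  have hNv : ((N : ℕ) : 𝓞 L₁) ∉ v.asIdeal := fun h => hMv (by
    rw [Nat.cast_mul]; exact v.asIdeal.mul_mem_right _ h)
  have hdisc : ¬ ((p : ℤ) ∣ NumberField.discr K) := fun h =>
    hpM (dvd_mul_of_dvd_right (Int.natCast_dvd.mp h) N)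
  haveI := hchar
  haveI : Fact p.Prime := ⟨hp⟩
  --     the data at `v`, read off the one binder: `Rfam`, `Hfam`, the conjFrob companions at `a := none`, F-S5c for EVERY `ℓ′`
  obtain ⟨Rfam, Hfam, hrest⟩ := hSdata v hvS
  obtain ⟨Hγfam, Hγ'fam, hS5cv⟩ := hrest (F₀ := traceField Φ) none γ hγv p 1 hcard
  have hdata : ∀ (ℓ' : ℕ) [Fact ℓ'.Prime],
      HomReduction.exists_isTateCompatible_family_conjFrob Rfam Hfam none γ hγv p 1 hcard Hγfam Hγ'fam ℓ' :=
    fun ℓ' _ => hS5cv ℓ'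
  let R : (A₀.baseChange L₁).GoodReductionAt v := Rfam none
  have hℓv : ((ℓ : ℕ) : 𝓞 L₁) ∉ v.asIdeal := fun h => hNv (by
    obtain ⟨m, rfl⟩ := hℓN
    rw [Nat.cast_mul]; exact v.asIdeal.mul_mem_right _ h)
  -- §3  G4: `𝔭 := v ∩ K*`, `𝔭 ∤ N`, `[s, K*]|_{C_N} = Frob_𝔭` (B-p06); `N𝔭 = p`; the uniformiser `ϖ`
  obtain ⟨𝔭, h𝔭v, h𝔭N, hsF⟩ :=
    exists_abRestrict_ideleArtinMap_eq_galFrob_of_isArtinLift (traceField Φ) hN0 hs γ hσγ j hNv hγv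
  have hq𝔭 : Ideal.absNorm 𝔭.asIdeal = p ^ 1 := by
    rw [Ideal.absNorm_apply, Submodule.cardQuot_apply, h𝔭v]; exact hcard
  have hϖ := HeckeCharacter.valued_uniformizer (K := traceField Φ) 𝔭
  -- §5  TT-idèle: `d₀`, torsion congruence (clause 2), lattice identity (clause 3), norm identity (clause 4),
  --     and the five arithmetic conjuncts for the lattice `𝔞` (B-p19)
  obtain ⟨d₀, -, hcong, hlat, hnorm⟩ :=
    exists_reflexNorm_torsionCongruence_of_abRestrict_ideleArtinMap_eq_galFrob K Φ (traceField Φ) hN0 h𝔭N hϖ hsF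
  obtain ⟨hβ0, hq0, hν, h𝔞β𝔟, ht⟩ :=
    levelArithmetic_of_latticeIdentity K Φ (traceField Φ) le_rfl hN0 hℓN h𝔭N hϖ (hlat 𝔞) hnorm
  -- §6  G6: `𝔮 = g(𝔭) = il(g(c₀)_𝐡)`, `𝔟ᵢ := g(c₀)_𝐡⁻¹𝔞 = 𝔮⁻¹𝔞`, `𝔮𝔟ᵢ = 𝔞` (B-p19)
  obtain ⟨𝔮, 𝔟ᵢ, h𝔮w, h𝔮𝔟ᵢ, h𝔮0, hil𝔮, h𝔟ᵢ_def, h𝔮count⟩ :=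
    exists_reflexTypeNorm_bridge_traceField (K := K) (Φ := Φ) 𝔭 hϖ 𝔞
  --     the lattice identity in the form G11a consumes: `g(s)_𝐡⁻¹𝔞 = g(d₀)·𝔟ᵢ` (from clause 3 + `h𝔟ᵢ_def`)
  have h𝔠 : IdeleAction.ideleMulIdeal (reflexNormFiniteIdele K Φ (traceField Φ)
        (IdeleAction.finitePart (traceField Φ) s))⁻¹ (𝔞 : FractionalIdeal (𝓞 K)⁰ K) =
      spanSingleton (𝓞 K)⁰ (reflexNormFrom K Φ (traceField Φ) d₀ * (1 : K)⁻¹) * (𝔟ᵢ : FractionalIdeal (𝓞 K)⁰ K) := by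
    have hg0 : reflexNormFrom K Φ (traceField Φ) d₀ ≠ 0 := fun h => hβ0 (by rw [h, inv_zero])
    have hcoe : (𝔟ᵢ : FractionalIdeal (𝓞 K)⁰ K) = IdeleAction.ideleMulIdeal (reflexNormFiniteIdele K Φ (traceField Φ)
        (IdeleAction.finitePart (traceField Φ) (localUnits 𝔭 (HeckeCharacter.uniformizer (traceField Φ) 𝔭))))⁻¹
          (𝔞 : FractionalIdeal (𝓞 K)⁰ K) := by
      rw [h𝔟ᵢ_def]; rfl
    rw [inv_one, mul_one, hcoe, hlat 𝔞, ← mul_assoc, FractionalIdeal.spanSingleton_mul_spanSingleton,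
      mul_inv_cancel₀ hg0, FractionalIdeal.spanSingleton_one, one_mul]
  -- §7  the class representative `A_c`, `c = [𝔟ᵢ]`, re-uniformised to type EXACTLY `𝔟ᵢ`
  set c : ClassGroup (𝓞 K) := ClassGroup.mk K 𝔟ᵢ with hc_def
  obtain ⟨bᵢ, η, hbᵢ, -, -, -⟩ := (ηrep c).exists_reindex_of_classGroup_mk_eq (𝔟 := 𝔟ᵢ) (by rw [h𝔞rep c])
  let Rᵢ : (Arep c).GoodReductionAt v := Rfam (some c)
  let H0i : HomReduction R Rᵢ := Hfam none (some c)
  let Hiγ : HomReduction Rᵢ (R.conjFrob γ hγv p 1 hcard) := Hγfam (some c)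
  let Hγi : HomReduction (R.conjFrob γ hγv p 1 hcard) Rᵢ := Hγ'fam (some c)
  let H0γ : HomReduction R (R.conjFrob γ hγv p 1 hcard) := Hγfam none
  -- §8  `ξ₁ = T⁻¹ ∘ ξ` on the model `(A₀ ⊗ L₁) ⊗ ℂ` (B-p20); the model is of type `(K, Φ)`
  obtain ⟨ξ₁, hξ₁⟩ := ξ.exists_tower_source (L₁ := L₁)
  have hA : IsCMTypeRealisationOver Φ (A₀.baseChange L₁) ((endBaseChange L₁ A₀).comp ι₀) := hA₀.baseChange
  -- §9  the `ℓ`-adic block at `v` (F-S5c at `ℓ`, same `Rfam`/`Hfam`)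
  obtain ⟨Tfam, Tγ, σℓ, hσℓa, hσℓb, hTTfam, hTTγ, hHT, hHγT, hHγ'T, h2'⟩ := hdata ℓ hℓv
  let T0 : R.TateSpecialisation ℓ := Tfam none
  let Ti : Rᵢ.TateSpecialisation ℓ := Tfam (some c)
  have h0i : H0i.IsTateCompatible T0 Ti := hHT none (some c)
  have hiγT : Hiγ.IsTateCompatible Ti Tγ := hHγT (some c)
  have hγiT : Hγi.IsTateCompatible Tγ Ti := hHγ'T (some c)
  have h0γ : H0γ.IsTateCompatible T0 Tγ := hHγT none
  -- §10–§12  the `𝔮`-multiplication `λ`, the Shimura–Taniyama `ψ` (F-S2) and `θ : A_c ≅ (A₀⊗L₁)^γ` with `κ̃ = π` (G10)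
  --     (B-p12 `exists_hom_iso_redHom_comp_eq_relFrobenius_of_pair_degOne`: G7 λ + F-S2₁ ψ + S3/G10 θ)
  obtain ⟨lam, θ, hlamι, hlam, hθι, hκ⟩ :
      ∃ (lam : A₀.baseChange L₁ ⟶ Arep c) (θ : Arep c ≅ (A₀.baseChange L₁).conjugate γ.toRingEquiv),
        (∀ a : 𝓞 K, (((endBaseChange L₁ A₀).comp ι₀) a : A₀.baseChange L₁ ⟶ A₀.baseChange L₁) ≫ lam =
          lam ≫ (ιrep c a : Arep c ⟶ Arep c)) ∧
        (∀ u : K, AlgPoints.map (Hom.baseChange ℂ lam).hom.hom.hom (ξ₁.r u) = η.r u) ∧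
        (∀ a : 𝓞 K, (ιrep c a : Arep c ⟶ Arep c) ≫ θ.hom =
          θ.hom ≫ ((((A₀.baseChange L₁).endConjugate γ.toRingEquiv).comp ((endBaseChange L₁ A₀).comp ι₀)) a :
            (A₀.baseChange L₁).conjugate γ.toRingEquiv ⟶ _)) ∧
        H0γ.redHom (lam ≫ θ.hom) = R.reduction.relFrobenius p 1 :=
    exists_hom_iso_redHom_comp_eq_relFrobenius_of_pair_degOne' Φ 𝔞 𝔟ᵢ 𝔮 (A₀.baseChange L₁) (Arep c)
      ((endBaseChange L₁ A₀).comp ι₀) (ιrep c) hS2 h𝔮𝔟ᵢ hA ξ₁ η (hrat c) σ γ hσγ (hratγ c)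
      (hratγ' c) v 𝔭 h𝔭v hγv p hcard hdisc h𝔮w R Rᵢ H0i Hiγ Hγi H0γ hℓv T0 Ti Tγ h0i hiγT hγiT h0γ
  set κ : A₀.baseChange L₁ ⟶ (A₀.baseChange L₁).conjugate γ.toRingEquiv := lam ≫ θ.hom with hκ_def
  -- §13  `ξs := θ_ℂ ∘ η` on `((A₀⊗L₁)^γ) ⊗ ℂ`, type `𝔟ᵢ`, with `ξs = κ_ℂ ∘ ξ₁` on `r`; `ξ₂ := E ∘ ξs` on the junction carrier
  obtain ⟨ξs, hξs⟩ : ∃ ξs : CMTypeUniformization Φ 𝔟ᵢ (((A₀.baseChange L₁).conjugate γ.toRingEquiv).baseChange ℂ)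
      ((endBaseChange ℂ ((A₀.baseChange L₁).conjugate γ.toRingEquiv)).comp
        (((A₀.baseChange L₁).endConjugate γ.toRingEquiv).comp ((endBaseChange L₁ A₀).comp ι₀))),
      ∀ u : K, ξs.r u = AlgPoints.map (Hom.baseChange ℂ κ).hom.hom.hom (ξ₁.r u) := by
    -- `θ ⊗ ℂ` as an isomorphism of the complexifications, `𝓞_K`-equivariant by `hθι`
    let eθ : (Arep c).baseChange ℂ ≅ ((A₀.baseChange L₁).conjugate γ.toRingEquiv).baseChange ℂ :=
      { hom := Hom.baseChange ℂ θ.hom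
        inv := Hom.baseChange ℂ θ.inv
        hom_inv_id := by rw [← Hom.baseChange_comp, θ.hom_inv_id, Hom.baseChange_id]
        inv_hom_id := by rw [← Hom.baseChange_comp, θ.inv_hom_id, Hom.baseChange_id] }
    have heθ : ∀ a : 𝓞 K, ((endBaseChange ℂ (Arep c)).comp (ιrep c)) a ≫ eθ.hom =
        eθ.hom ≫ ((endBaseChange ℂ ((A₀.baseChange L₁).conjugate γ.toRingEquiv)).comp
          (((A₀.baseChange L₁).endConjugate γ.toRingEquiv).comp ((endBaseChange L₁ A₀).comp ι₀))) a := by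
      intro a
      change Hom.baseChange ℂ (ιrep c a : Arep c ⟶ Arep c) ≫ Hom.baseChange ℂ θ.hom =
        Hom.baseChange ℂ θ.hom ≫ Hom.baseChange ℂ
          ((((A₀.baseChange L₁).endConjugate γ.toRingEquiv).comp ((endBaseChange L₁ A₀).comp ι₀)) a :
            (A₀.baseChange L₁).conjugate γ.toRingEquiv ⟶ _)
      rw [← Hom.baseChange_comp, ← Hom.baseChange_comp, hθι a]
    refine ⟨η.ofIso eθ heθ, fun u => ?_⟩
    rw [CMTypeUniformization.ofIso_r, ← hlam u, hκ_def, Hom.baseChange_comp, AbelianVariety.map_hom_comp]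
  obtain ⟨ξ₂, hξ₂⟩ := ξs.exists_conjugate_tower_target (L := L) A₀ ι₀ γ.toRingEquiv σ.toRingEquiv hσγ
  -- §14  (2)_N: «κ = γ on (A₀⊗L₁)(L₁)[N]» (B-p09 per prime power ∘ B-p19 assembly, fed by `hdata` at each ℓ′ ∣ N),
  --      read in ℂ (B-p09 `conjPoints_eq_map_comp_of_forall_torsion` with `htors`), then the reindex (B-p19)
  have hκN : ∀ x ∈ (A₀.baseChange L₁).torsionPoints L₁ (N : ℤ),
      AlgPoints.map κ.hom.hom.hom x = (A₀.baseChange L₁).conjPoints γ.toRingEquiv x := by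
    refine HomReduction.map_eq_conjPoints_of_forall_prime γ.toRingEquiv κ hN0 fun ℓ' hℓ' hℓ'N m x hx => ?_
    haveI : Fact ℓ'.Prime := ⟨hℓ'⟩
    have hℓ'v : ((ℓ' : ℕ) : 𝓞 L₁) ∉ v.asIdeal := fun h => hNv (by
      obtain ⟨m', rfl⟩ := hℓ'N
      rw [Nat.cast_mul]; exact v.asIdeal.mul_mem_right _ h)
    obtain ⟨T', Tγ', σ', hσ'a, -, -, -, -, hHγT', -, h2''⟩ := hdata ℓ' hℓ'v
    refine HomReduction.map_eq_conjPoints_of_geomTorsion_clause (A₀ := A₀.baseChange L₁) (R := R)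
      (Rγ := R.conjFrob γ hγv p 1 hcard) (p := p) (n := 1) (TA := T' none) (Tγ := Tγ') (Hγ := H0γ)
      γ.toRingEquiv (Iso.refl _) (hHγT' none) hℓ'v σ' hσ'a m
      (fun y y' hy' => ?_) κ ((Category.comp_id _).trans hκ) x hx
    exact (h2'' m y y' hy').trans (DFunLike.congr_fun (Hom.geomPointsMap_id _) _).symm
  have hF : ∀ u : K, ((N : ℕ) : K) * u ∈ (𝔞 : FractionalIdeal (𝓞 K)⁰ K) →
      (A₀.baseChange ℂ).conjPoints σ.toRingEquiv (ξ.r u) = ξ₂.r ((1 : K) * u) := by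
    intro u hu
    have hP : ξ.r u ∈ (A₀.baseChange ℂ).torsionPoints ℂ (N : ℤ) := ξ.r_nsmul_mem N u hu
    have hTinv : AlgPoints.map (baseChangeTowerIso L L₁ ℂ A₀).inv.hom.hom.hom (ξ.r u) = ξ₁.r u := by
      rw [hξ₁ u, ← AlgPoints.map_comp_apply]
      have h : (baseChangeTowerIso L L₁ ℂ A₀).hom.hom.hom.hom ≫ (baseChangeTowerIso L L₁ ℂ A₀).inv.hom.hom.hom = 𝟙 _ :=
        congr_arg (fun f : (A₀.baseChange L₁).baseChange ℂ ⟶ (A₀.baseChange L₁).baseChange ℂ => f.hom.hom.hom)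
          (baseChangeTowerIso L L₁ ℂ A₀).hom_inv_id
      rw [h, AlgPoints.map_id_apply]
    rw [AbelianVariety.conjPoints_eq_map_of_forall_torsion A₀ γ.toRingEquiv σ.toRingEquiv hσγ κ (N : ℤ) htors hκN _ hP,
      hTinv, ← hξs u, ← hξ₂ u, one_mul]
  obtain ⟨ξ', h2N, hξ'g, hξ'⟩ :=
    ξ.exists_reindex_forall_conj_eq_of_torsionCongruence_units ξ₂
      ((A₀.baseChange ℂ).conjPoints σ.toRingEquiv)
      (reflexNormFiniteIdele K Φ (traceField Φ) (IdeleAction.finitePart (traceField Φ) s))⁻¹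
      (N := N) (b := (1 : K)) (g := reflexNormFrom K Φ (traceField Φ) d₀) one_ne_zero
      (inv_ne_zero hβ0 |> fun h => by simpa using h) hF (fun u hu => hcong 𝔞 𝔞.ne_zero u hu) h𝔠
  -- §16  assembly (the junction spells `t = g(s)_𝐡⁻¹` through `reflexNormFinitePart`; B-p19's TT through
  --      `reflexNormFiniteIdele … (finitePart s)`: one rewrite)
  have ht_eq : reflexNormFinitePart K Φ (traceField Φ) s =
      reflexNormFiniteIdele K Φ (traceField Φ) (IdeleAction.finitePart (traceField Φ) s) :=
    reflexNormFinitePart_eq K Φ (traceField Φ) s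
  rw [ht_eq]
  refine ⟨ξ', Ideal.absNorm 𝔭.asIdeal, (reflexNormFrom K Φ (traceField Φ) d₀)⁻¹, ?_, hβ0, hq0, hν, h𝔞β𝔟, ht, ?_⟩
  · -- (2)_N
    intro u w hu huw
    rw [ht_eq] at huw
    exact h2N u w hu huw
  · -- §15  PAIR (B-p20 p609331 `weilPairingLevel_conjugate_reindex_eq_pow_of_model` = S5 on the model + transports)
    -- «κ_{L̄₁} = σ̃-conjugation on ℓ-power torsion» (step 11, p604665 at e := Iso.refl, from (2′) `h2'` and `hκ`)
    have hκ' : H0γ.redHom κ ≫ (Iso.refl ((R.conjFrob γ hγv p 1 hcard).reduction)).hom =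
        R.reduction.relFrobenius p 1 := (Category.comp_id _).trans hκ
    have hκσ' : ∀ (k : ℕ) (x : ((A₀.baseChange L₁).baseChange (AlgebraicClosure L₁)).torsionPoints
        (AlgebraicClosure L₁) (ℓ ^ k : ℕ)),
        AlgPoints.map (conjugateBaseChangeAlongIso γ.toRingEquiv σℓ hσℓa (A₀.baseChange L₁)).hom.hom.hom.hom
            (AlgPoints.map (Hom.baseChange (AlgebraicClosure L₁) κ).hom.hom.hom x.1) =
          ((A₀.baseChange L₁).baseChange (AlgebraicClosure L₁)).conjPoints σℓ x.1 := fun k x =>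
      HomReduction.map_conjugateBaseChangeAlongIso_baseChange_eq_conjPoints (A₀ := A₀.baseChange L₁) (R := R)
        (Rγ := R.conjFrob γ hγv p 1 hcard) (p := p) (n := 1) (TA := T0) (Tγ := Tγ) (Hγ := H0γ) γ.toRingEquiv
        (Iso.refl _) h0γ hℓv σℓ
        hσℓa k (fun y y' hy' => (h2' k y y' hy').trans (DFunLike.congr_fun (Hom.geomPointsMap_id _) _).symm) κ
        hκ' x
    -- κ = λ ≫ θ is dominant (isogeny followed by an iso) over L₁, ℂ and L̄₁ (B-p10 `isIsogeny_of_map_baseChange_r_eq`)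
    have hκisog : IsIsogeny κ := AbelianVariety.isIsogeny_comp_iso_hom
      (CMTypeUniformization.isIsogeny_of_map_baseChange_r_eq ξ₁ η (hrat' c) 𝔮 h𝔮𝔟ᵢ hlam) θ
    haveI hdomκ : IsDominant (Hom.toSchemeHom κ) := hκisog.isDominant_toSchemeHom
    haveI hdomκℂ : IsDominant (Hom.toSchemeHom (Hom.baseChange ℂ κ)) := hκisog.isDominant_toSchemeHom_baseChange ℂ
    haveI hdomκbar : IsDominant (Hom.toSchemeHom (Hom.baseChange (AlgebraicClosure L₁) κ)) :=
      hκisog.isDominant_toSchemeHom_baseChange (AlgebraicClosure L₁)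
    -- `𝔟ᵢ = β · g(s)_𝐡⁻¹𝔞` and `ξ' = ξ₂ ∘ S(β)`, `β = g(d₀)⁻¹`
    have hg0 : reflexNormFrom K Φ (traceField Φ) d₀ ≠ 0 := fun h => hβ0 (by rw [h, inv_zero])
    have h𝔠β : (𝔟ᵢ : FractionalIdeal (𝓞 K)⁰ K) = spanSingleton (𝓞 K)⁰ (reflexNormFrom K Φ (traceField Φ) d₀)⁻¹ *
        ((ideleMulIdealUnits (reflexNormFiniteIdele K Φ (traceField Φ)
          (IdeleAction.finitePart (traceField Φ) s))⁻¹ 𝔞 : (FractionalIdeal (𝓞 K)⁰ K)ˣ) : FractionalIdeal (𝓞 K)⁰ K) := by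
      change _ = _ * IdeleAction.ideleMulIdeal _ _
      rw [h𝔠, ← mul_assoc, FractionalIdeal.spanSingleton_mul_spanSingleton, inv_one, mul_one,
        inv_mul_cancel₀ hg0, FractionalIdeal.spanSingleton_one, one_mul]
    have hξ'β : ∀ w : K, ξ'.r w = ξ₂.r ((reflexNormFrom K Φ (traceField Φ) d₀)⁻¹ * w) := fun w => by
      rw [hξ' w, inv_one, mul_one]
    exact weilPairingLevel_conjugate_reindex_eq_pow_of_model A₀ ι₀ X πA hπA ξ σ.toRingEquiv πσ hπσ ℓ ξ' γ hσγ v hγv R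
      p 1 hcard H0γ κ hκ hℓv σℓ hσℓa hσℓb hκσ' ξ₁ hξ₁ ξ₂ (fun u => by rw [hξ₂ u, hξs u])
      (Ideal.absNorm 𝔭.asIdeal) hq𝔭.symm _ h𝔠β hξ'β

/-- **Edition `S5c′` with the degree-one pair fact `S2₁`** (hypothesis `hS2 : shimuraTaniyamaPair_degOne`; the statement landed as
p618655, byte-identical): one line from the unramified edition `exists_isLevelUniformization_of_levelField_degOne''` via the bridge
`shimuraTaniyamaPair_degOne'_of` (E1′ re-cut: the heavy proof lives under `…_degOne''`; consumers `levelStructure_of_facts_degOne'`,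
b2-main v2s do not move).
[cite: Shimura1998, §18.6 proof of Thm. 18.6, pp. 125–129 (esp. pp. 127–128); §13.1 Thm. 1 (i) (p. 97); §11.1 Prop. 12 (p. 83) and Prop. 14 (i) (p. 85)] -/
theorem exists_isLevelUniformization_of_levelField_degOne'
    {K : Type} [Field K] [NumberField K] [IsCMField K] (Φ : CMType K) [NumberField (traceField Φ)]
    (𝔞 𝔟 : (FractionalIdeal (𝓞 K)⁰ K)ˣ)
    {L : Type} [Field L] [NumberField L] [Algebra L ℂ] (A₀ : AbelianVariety L) (ι₀ : 𝓞 K →+* End A₀)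
    (hA₀ : IsCMTypeRealisationOver Φ A₀ ι₀)
    (X : CartierDivisor A₀.X.left)
    (πA : (A₀.baseChange ℂ).X.left ⟶ A₀.X.left) (hπA : πA = pullback.fst A₀.X.hom (bcSpec L ℂ)) [IsDominant πA]
    (ξ : CMTypeUniformization Φ 𝔞 (A₀.baseChange ℂ) ((endBaseChange ℂ A₀).comp ι₀))
    (σ : ℂ ≃ₐ[traceField Φ] ℂ) (s : ideleGroup (traceField Φ)) (hs : IsArtinLift (traceField Φ) s σ)
    (h𝔟 : 𝔟 = ideleMulIdealUnits (reflexNormFinitePart K Φ (traceField Φ) s)⁻¹ 𝔞)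
    (πσ : ((A₀.baseChange ℂ).conjugate σ.toRingEquiv).X.left ⟶ (A₀.baseChange ℂ).X.left)
    (hπσ : πσ = baseChangeHomFst σ.toRingEquiv.toRingHom (A₀.baseChange ℂ).X) [IsDominant πσ]
    (ℓ : ℕ) [Fact ℓ.Prime]
    [hdomA : ∀ k : ℕ, IsDominant (Hom.toSchemeHom (((ℓ ^ k : ℕ) : ℤ) • 𝟙 (A₀.baseChange ℂ)))]
    [hdomσ : ∀ k : ℕ,
      IsDominant (Hom.toSchemeHom (((ℓ ^ k : ℕ) : ℤ) • 𝟙 ((A₀.baseChange ℂ).conjugate σ.toRingEquiv)))]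
    (N : ℕ) (hN : 0 < N) (hℓN : ℓ ∣ N)
    -- level field `L₁ ⊇ L · K* · C_N`, Galois over `K*`, `σ(L₁) = L₁` with `σ|_{L₁} = γ`
    {L₁ : Type} [Field L₁] [NumberField L₁] [Algebra L L₁] [Algebra L₁ ℂ] [IsScalarTower L L₁ ℂ]
    [Algebra (traceField Φ) L₁] [IsScalarTower (traceField Φ) L₁ ℂ] [IsGalois (traceField Φ) L₁]
    (γ : L₁ ≃ₐ[traceField Φ] L₁) (hσγ : ∀ x : L₁, σ (algebraMap L₁ ℂ x) = algebraMap L₁ ℂ (γ x))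
    (j : rayClassField (traceField Φ) (Ideal.span {((N : ℕ) : 𝓞 (traceField Φ))}) →ₐ[traceField Φ] L₁)
    -- class representatives over `L₁` (W(ii) + G0 tower)
    (Arep : ClassGroup (𝓞 K) → AbelianVariety L₁) (ιrep : ∀ c, 𝓞 K →+* End (Arep c))
    (𝔞rep : ClassGroup (𝓞 K) → (FractionalIdeal (𝓞 K)⁰ K)ˣ) (h𝔞rep : ∀ c, ClassGroup.mk K (𝔞rep c) = c)
    (ηrep : ∀ c, CMTypeUniformization Φ (𝔞rep c) ((Arep c).baseChange ℂ) ((endBaseChange ℂ (Arep c)).comp (ιrep c)))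
    -- rationality over `L₁`: `N`-torsion of `A₀ ⊗ ℂ` (G2) and homomorphisms (G1)
    (htors : ∀ Q ∈ (A₀.baseChange ℂ).torsionPoints ℂ (N : ℤ),
      ∃ x ∈ (A₀.baseChange L₁).torsionPoints L₁ (N : ℤ),
        AlgPoints.map (baseChangeTowerIso L L₁ ℂ A₀).hom.hom.hom.hom
          ((A₀.baseChange L₁).pointsMulEquiv ℂ (AlgPoints.extendScalars (A₀.baseChange L₁).X L₁ ℂ x)) = Q)
    (hrat : ∀ c, Function.Surjective (Hom.baseChange ℂ :
      (A₀.baseChange L₁ ⟶ Arep c) → ((A₀.baseChange L₁).baseChange ℂ ⟶ (Arep c).baseChange ℂ)))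
    (hrat' : ∀ c, Function.Surjective (Hom.baseChange ℂ :
      (Arep c ⟶ A₀.baseChange L₁) → ((Arep c).baseChange ℂ ⟶ (A₀.baseChange L₁).baseChange ℂ)))
    (hratγ : ∀ c, Function.Surjective (Hom.baseChange ℂ :
      (Arep c ⟶ (A₀.baseChange L₁).conjugate γ.toRingEquiv) →
        ((Arep c).baseChange ℂ ⟶ ((A₀.baseChange L₁).conjugate γ.toRingEquiv).baseChange ℂ)))
    (hratγ' : ∀ c, Function.Surjective (Hom.baseChange ℂ :
      ((A₀.baseChange L₁).conjugate γ.toRingEquiv ⟶ Arep c) →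
        (((A₀.baseChange L₁).conjugate γ.toRingEquiv).baseChange ℂ ⟶ (Arep c).baseChange ℂ)))
    -- the named facts: the Shimura–Taniyama pair fact AT ABSOLUTE DEGREE ONE (E1, `shimuraTaniyamaPair_degOne`), then `FactRH′`, (F-S5c)
    -- the named facts: the Shimura–Taniyama pair fact AT ABSOLUTE DEGREE ONE (E1) and the merged reduction fact `S5c′` (E4)
    (hS2 : shimuraTaniyamaPair_degOne)
    (hRHS5c : AbelianVariety.exists_finite_forall_exists_goodReductionAt_homReduction_conjFrob_isTateCompatible) :
    ∃ (ξ' : CMTypeUniformization Φ 𝔟 ((A₀.baseChange ℂ).conjugate σ.toRingEquiv)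
        (((A₀.baseChange ℂ).endConjugate σ.toRingEquiv).comp ((endBaseChange ℂ A₀).comp ι₀))) (q : ℕ) (β : K),
      IsLevelUniformization Φ 𝔞 𝔟 A₀ ι₀ X πA ξ σ s πσ ℓ N ξ' q β
        ((FractionalIdeal.absNorm (toFractionalIdeal (𝓞 (traceField Φ)) (traceField Φ)
          (IdeleAction.finitePart (traceField Φ) s)) : ℚ) : K) :=
  exists_isLevelUniformization_of_levelField_degOne'' Φ 𝔞 𝔟 A₀ ι₀ hA₀ X πA hπA ξ σ s hs h𝔟 πσ hπσ ℓ N hN hℓN γ hσγ j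
    Arep ιrep 𝔞rep h𝔞rep ηrep htors hrat hrat' hratγ hratγ' (shimuraTaniyamaPair_degOne'_of hS2) hRHS5c

/-- **Edition `S5c′` with the full pair fact** (hypothesis `hS2 : shimuraTaniyamaPair`, row II-1-S2): one line from the degree-one
edition `exists_isLevelUniformization_of_levelField_degOne'` via the bridge `shimuraTaniyamaPair_degOne_of`.  Shimura 1998, proof of
Thm. 18.6 for ONE level `N` over a chosen level field, from (F-S2) `shimuraTaniyamaPair` and the merged reduction fact `S5c′` as
hypotheses.
[cite: Shimura1998, §18.6 proof of Thm. 18.6, pp. 125–129 (esp. pp. 127–128); §13.1 Thm. 1 (i) (p. 97); §11.1 Prop. 12 (p. 83) and Prop. 14 (i) (p. 85)] -/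
theorem exists_isLevelUniformization_of_levelField'
    {K : Type} [Field K] [NumberField K] [IsCMField K] (Φ : CMType K) [NumberField (traceField Φ)]
    (𝔞 𝔟 : (FractionalIdeal (𝓞 K)⁰ K)ˣ)
    {L : Type} [Field L] [NumberField L] [Algebra L ℂ] (A₀ : AbelianVariety L) (ι₀ : 𝓞 K →+* End A₀)
    (hA₀ : IsCMTypeRealisationOver Φ A₀ ι₀)
    (X : CartierDivisor A₀.X.left)
    (πA : (A₀.baseChange ℂ).X.left ⟶ A₀.X.left) (hπA : πA = pullback.fst A₀.X.hom (bcSpec L ℂ)) [IsDominant πA]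
    (ξ : CMTypeUniformization Φ 𝔞 (A₀.baseChange ℂ) ((endBaseChange ℂ A₀).comp ι₀))
    (σ : ℂ ≃ₐ[traceField Φ] ℂ) (s : ideleGroup (traceField Φ)) (hs : IsArtinLift (traceField Φ) s σ)
    (h𝔟 : 𝔟 = ideleMulIdealUnits (reflexNormFinitePart K Φ (traceField Φ) s)⁻¹ 𝔞)
    (πσ : ((A₀.baseChange ℂ).conjugate σ.toRingEquiv).X.left ⟶ (A₀.baseChange ℂ).X.left)
    (hπσ : πσ = baseChangeHomFst σ.toRingEquiv.toRingHom (A₀.baseChange ℂ).X) [IsDominant πσ]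
    (ℓ : ℕ) [Fact ℓ.Prime]
    [hdomA : ∀ k : ℕ, IsDominant (Hom.toSchemeHom (((ℓ ^ k : ℕ) : ℤ) • 𝟙 (A₀.baseChange ℂ)))]
    [hdomσ : ∀ k : ℕ,
      IsDominant (Hom.toSchemeHom (((ℓ ^ k : ℕ) : ℤ) • 𝟙 ((A₀.baseChange ℂ).conjugate σ.toRingEquiv)))]
    (N : ℕ) (hN : 0 < N) (hℓN : ℓ ∣ N)
    -- level field `L₁ ⊇ L · K* · C_N`, Galois over `K*`, `σ(L₁) = L₁` with `σ|_{L₁} = γ`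
    {L₁ : Type} [Field L₁] [NumberField L₁] [Algebra L L₁] [Algebra L₁ ℂ] [IsScalarTower L L₁ ℂ]
    [Algebra (traceField Φ) L₁] [IsScalarTower (traceField Φ) L₁ ℂ] [IsGalois (traceField Φ) L₁]
    (γ : L₁ ≃ₐ[traceField Φ] L₁) (hσγ : ∀ x : L₁, σ (algebraMap L₁ ℂ x) = algebraMap L₁ ℂ (γ x))
    (j : rayClassField (traceField Φ) (Ideal.span {((N : ℕ) : 𝓞 (traceField Φ))}) →ₐ[traceField Φ] L₁)
    -- class representatives over `L₁` (W(ii) + G0 tower)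
    (Arep : ClassGroup (𝓞 K) → AbelianVariety L₁) (ιrep : ∀ c, 𝓞 K →+* End (Arep c))
    (𝔞rep : ClassGroup (𝓞 K) → (FractionalIdeal (𝓞 K)⁰ K)ˣ) (h𝔞rep : ∀ c, ClassGroup.mk K (𝔞rep c) = c)
    (ηrep : ∀ c, CMTypeUniformization Φ (𝔞rep c) ((Arep c).baseChange ℂ) ((endBaseChange ℂ (Arep c)).comp (ιrep c)))
    -- rationality over `L₁`: `N`-torsion of `A₀ ⊗ ℂ` (G2) and homomorphisms (G1)
    (htors : ∀ Q ∈ (A₀.baseChange ℂ).torsionPoints ℂ (N : ℤ),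
      ∃ x ∈ (A₀.baseChange L₁).torsionPoints L₁ (N : ℤ),
        AlgPoints.map (baseChangeTowerIso L L₁ ℂ A₀).hom.hom.hom.hom
          ((A₀.baseChange L₁).pointsMulEquiv ℂ (AlgPoints.extendScalars (A₀.baseChange L₁).X L₁ ℂ x)) = Q)
    (hrat : ∀ c, Function.Surjective (Hom.baseChange ℂ :
      (A₀.baseChange L₁ ⟶ Arep c) → ((A₀.baseChange L₁).baseChange ℂ ⟶ (Arep c).baseChange ℂ)))
    (hrat' : ∀ c, Function.Surjective (Hom.baseChange ℂ :
      (Arep c ⟶ A₀.baseChange L₁) → ((Arep c).baseChange ℂ ⟶ (A₀.baseChange L₁).baseChange ℂ)))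
    (hratγ : ∀ c, Function.Surjective (Hom.baseChange ℂ :
      (Arep c ⟶ (A₀.baseChange L₁).conjugate γ.toRingEquiv) →
        ((Arep c).baseChange ℂ ⟶ ((A₀.baseChange L₁).conjugate γ.toRingEquiv).baseChange ℂ)))
    (hratγ' : ∀ c, Function.Surjective (Hom.baseChange ℂ :
      ((A₀.baseChange L₁).conjugate γ.toRingEquiv ⟶ Arep c) →
        (((A₀.baseChange L₁).conjugate γ.toRingEquiv).baseChange ℂ ⟶ (Arep c).baseChange ℂ)))
    -- the named facts (E4: `S5c′` replaces `FactRH′` + F-S5c)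
    (hS2 : shimuraTaniyamaPair)
    (hRHS5c : AbelianVariety.exists_finite_forall_exists_goodReductionAt_homReduction_conjFrob_isTateCompatible) :
    ∃ (ξ' : CMTypeUniformization Φ 𝔟 ((A₀.baseChange ℂ).conjugate σ.toRingEquiv)
        (((A₀.baseChange ℂ).endConjugate σ.toRingEquiv).comp ((endBaseChange ℂ A₀).comp ι₀))) (q : ℕ) (β : K),
      IsLevelUniformization Φ 𝔞 𝔟 A₀ ι₀ X πA ξ σ s πσ ℓ N ξ' q β
        ((FractionalIdeal.absNorm (toFractionalIdeal (𝓞 (traceField Φ)) (traceField Φ)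
          (IdeleAction.finitePart (traceField Φ) s)) : ℚ) : K) :=
  exists_isLevelUniformization_of_levelField_degOne' Φ 𝔞 𝔟 A₀ ι₀ hA₀ X πA hπA ξ σ s hs h𝔟 πσ hπσ ℓ N hN hℓN γ hσγ j
    Arep ιrep 𝔞rep h𝔞rep ηrep htors hrat hrat' hratγ hratγ' (shimuraTaniyamaPair_degOne_of hS2) hRHS5c

end Literature.NumberTheory.ComplexMultiplication

end
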